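import Summits.ResolutionOfSingularities.ResolutionOfSingularities.Theorems.FrobeniusLadderFRationalResolutionVertexChartMonoid
import Literature.AlgebraicGeometry.Resolution.LogChartFaceSplitting
import HarnessLib

/-!
# Crux `FrobeniusLadder.FRationalResolution` (stmt-ResolutionOfSingularities-15317), line `redirect`,
# stub `stub_diagonalizableQuotientResolution` — **faces and localisations of the rank-two vertex chart
# monoid** (point-blow-up recursion for the surface case over arbitrary fields, memo MEMO-15317-leafhand2-g6
# §4, brick P4; continues `…VertexChartMonoid`)

For a vertex chart monoid `Q = L + {m·v + l·x : m ≥ 0, m + c·l ≥ 0}` (`(v, x)` independent modulo `L`,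
`y = c·v − x`), the data consumed by `…ChartAlgebraOrthantPoints` at the NON-fixed points of the chart:

* `face_contains_generator` — a face `G` of `Q` containing an element outside `L` contains one of the
  three generators `v`, `x`, `y` (so at a non-fixed prime of the chart algebra one of `χ(v), χ(x), χ(y)`
  is a unit);
* `mem_awayMonoid_x_iff` — the localisation `Q⟨−x⟩ = L + ℕv + ℤx`; by the symmetry `x ↔ y`
  (`…VertexChartMonoid.vertex_symm`) also `Q⟨−y⟩ = L + ℕv + ℤy`; `mem_awayMonoid_v_iff` —
  `Q⟨−v⟩ = L + ℤv + ℤx` (everything, when `L + ℤv + ℤx = ℤⁿ`): all three are of the shape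
  `L ⊕ ℕ^I ⊕ ℤ^J`, i.e. orthant-like in a basis adapted to `L ⊕ ℤv ⊕ ℤx`.

Honest label: combinatorics toward ONE leaf stub (no stub, crux or summit closed). No definitions, no named
facts, no sorry. [cite: Kato1994, (10.1)] [cite: KempfEtAl1973, Ch. I §2]
-/

-- single-problem summit: the doubled namespace component is forced
set_option linter.dupNamespace false

open Literature.AlgebraicGeometry.Resolution Literature.AlgebraicGeometry.Resolution.LogChart
open Summit.ResolutionOfSingularities.ResolutionOfSingularities.Theorems.FRationalResolution.VertexChartMonoid

namespace Summit.ResolutionOfSingularities.ResolutionOfSingularities.Theorems.FRationalResolution.VertexChartFaces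

variable {n : ℕ} {L : Submodule ℤ (Fin n → ℤ)} {Q : AddSubmonoid (Fin n → ℤ)} {v x : Fin n → ℤ} {c : ℕ}

/-! ### Faces through a non-unit contain a generator -/

/-- **A face of the vertex chart monoid not contained in `L` contains `v`, `x` or `y = c v − x`.**
Write the element as `g₀ + m v + l x`; if `l ≥ 0` it is `v + (…)` or `x + (…)` inside `Q`, and if
`l ≤ −1` it is `y + ((m − c) v + (l + 1) x)` inside `Q`. [cite: Kato1994, (10.1)] -/
theorem face_contains_generator
    (hQ : ∀ w, w ∈ Q ↔ ∃ g ∈ L, ∃ m l : ℤ, 0 ≤ m ∧ 0 ≤ m + (c : ℤ) * l ∧ w = g + m • v + l • x)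
    (hind : ∀ g ∈ L, ∀ m l : ℤ, g + m • v + l • x = 0 → m = 0 ∧ l = 0)
    {G : AddSubmonoid (Fin n → ℤ)} (hG : IsFaceOf G Q) {g : Fin n → ℤ} (hgG : g ∈ G) (hgL : g ∉ L) :
    v ∈ G ∨ x ∈ G ∨ (c : ℤ) • v - x ∈ G := by
  obtain ⟨g₀, hg₀, m, l, hm, hml, rfl⟩ := (hQ g).1 (hG.le hgG)
  rw [mem_L_iff hind hg₀] at hgL
  have hmem : ∀ m' l' : ℤ, 0 ≤ m' → 0 ≤ m' + (c : ℤ) * l' → g₀ + m' • v + l' • x ∈ Q :=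
    fun m' l' h1 h2 => (hQ _).2 ⟨g₀, hg₀, m', l', h1, h2, rfl⟩
  obtain ⟨f1, f2, f3⟩ := mul_le_facts c l
  have f5 := (mul_le_facts' c l 1).2
  push_cast at f5
  rcases le_or_gt 0 l with hl | hl
  · rcases le_or_gt 1 m with hm1 | hm1
    · -- `g = v + (g₀ + (m − 1) v + l x)`
      left
      have hrest : g₀ + (m - 1) • v + l • x ∈ Q := hmem _ _ (by omega) (by omega)
      have hv : v ∈ Q := (vertex_gens_mem hQ hind).1.1
      refine hG.mem_of_add_mem v hv _ hrest ?_
      have e : v + (g₀ + (m - 1) • v + l • x) = g₀ + m • v + l • x := by module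
      rw [e]; exact hgG
    · -- `m = 0`, `l ≥ 1`: `g = x + (g₀ + (l − 1) x)`
      right; left
      have hm0 : m = 0 := by omega
      have hl1 : 1 ≤ l := by omega
      have hrest : g₀ + (0 : ℤ) • v + (l - 1) • x ∈ Q := hmem _ _ le_rfl (by
        have := (mul_le_facts c (l - 1)).1 (by omega); simpa using this)
      have hx : x ∈ Q := (vertex_gens_mem hQ hind).2.1.1
      refine hG.mem_of_add_mem x hx _ hrest ?_
      have e : x + (g₀ + (0 : ℤ) • v + (l - 1) • x) = g₀ + m • v + l • x := by rw [hm0]; module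
      rw [e]; exact hgG
  · -- `l ≤ −1`: `g = y + (g₀ + (m − c) v + (l + 1) x)`
    right; right
    have hrest : g₀ + (m - (c : ℤ)) • v + (l + 1) • x ∈ Q := hmem _ _ (by omega) (by
      rw [mul_add, mul_one]; omega)
    have hy : (c : ℤ) • v - x ∈ Q := (vertex_gens_mem hQ hind).2.2.1
    refine hG.mem_of_add_mem _ hy _ hrest ?_
    have e : (c : ℤ) • v - x + (g₀ + (m - (c : ℤ)) • v + (l + 1) • x) = g₀ + m • v + l • x := by module
    rw [e]; exact hgG

/-! ### Localisations at the generators -/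

/-- **`Q⟨−x⟩ = L + ℕv + ℤx`**: the localisation of the vertex chart monoid at `x`
(`LogChart.awayMonoid`), given that `L + ℤv + ℤx = ℤⁿ`. [cite: Kato1994, (10.1)] -/
theorem mem_awayMonoid_x_iff
    (hQ : ∀ w, w ∈ Q ↔ ∃ g ∈ L, ∃ m l : ℤ, 0 ≤ m ∧ 0 ≤ m + (c : ℤ) * l ∧ w = g + m • v + l • x)
    (hind : ∀ g ∈ L, ∀ m l : ℤ, g + m • v + l • x = 0 → m = 0 ∧ l = 0)
    (hspan : ∀ w : Fin n → ℤ, ∃ g ∈ L, ∃ m l : ℤ, w = g + m • v + l • x)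
    (hx : x ∈ Q) (z : Fin n → ℤ) :
    z ∈ awayMonoid Q ⟨x, hx⟩ ↔ ∃ g ∈ L, ∃ m l : ℤ, 0 ≤ m ∧ z = g + m • v + l • x := by
  rw [mem_awayMonoid_iff]
  constructor
  · rintro ⟨k, hk⟩
    obtain ⟨g, hg, m, l, rfl⟩ := hspan z
    obtain ⟨g', hg', m', l', hm', hml', hEq⟩ := (hQ _).1 hk
    have e : g + m • v + l • x + k • ((⟨x, hx⟩ : Q) : Fin n → ℤ) = g + m • v + (l + k) • x := by
      change g + m • v + l • x + k • x = _
      rw [add_smul, ← natCast_zsmul x k]; abel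
    rw [e] at hEq
    obtain ⟨hm, -⟩ := coord_unique hind hg hg' hEq
    exact ⟨g, hg, m, l, by omega, rfl⟩
  · rintro ⟨g, hg, m, l, hm, rfl⟩
    refine ⟨l.natAbs, (hQ _).2 ⟨g, hg, m, l + l.natAbs, hm, ?_, ?_⟩⟩
    · have h1 : 0 ≤ l + (l.natAbs : ℤ) := by omega
      have := (mul_le_facts c (l + l.natAbs)).1 h1
      omega
    · change g + m • v + l • x + l.natAbs • x = _
      rw [add_smul, ← natCast_zsmul x l.natAbs]; abel

/-- **`Q⟨−v⟩ = L + ℤv + ℤx`** (everything): `v` is an interior element. [cite: Kato1994, (10.1)] -/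
theorem mem_awayMonoid_v_iff
    (hQ : ∀ w, w ∈ Q ↔ ∃ g ∈ L, ∃ m l : ℤ, 0 ≤ m ∧ 0 ≤ m + (c : ℤ) * l ∧ w = g + m • v + l • x)
    (hspan : ∀ w : Fin n → ℤ, ∃ g ∈ L, ∃ m l : ℤ, w = g + m • v + l • x)
    (hv : v ∈ Q) (z : Fin n → ℤ) :
    z ∈ awayMonoid Q ⟨v, hv⟩ ↔ ∃ g ∈ L, ∃ m l : ℤ, z = g + m • v + l • x := by
  rw [mem_awayMonoid_iff]
  constructor
  · intro _; exact hspan z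
  · rintro ⟨g, hg, m, l, rfl⟩
    -- `k = |m| + c |l|` works
    have hcl : 0 ≤ (c : ℤ) * (l.natAbs : ℤ) := by positivity
    refine ⟨m.natAbs + c * l.natAbs,
      (hQ _).2 ⟨g, hg, m + ((m.natAbs + c * l.natAbs : ℕ) : ℤ), l,
        by simp only [Nat.cast_add, Nat.cast_mul]; omega, ?_, ?_⟩⟩
    · simp only [Nat.cast_add, Nat.cast_mul]
      rcases le_or_gt 0 l with hl | hl
      · have := (mul_le_facts c l).1 hl
        omega
      · have e : (c : ℤ) * l = -((c : ℤ) * (l.natAbs : ℤ)) := by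
          rw [← mul_neg]; congr 1; omega
        omega
    · change g + m • v + l • x + (m.natAbs + c * l.natAbs) • v = _
      rw [← natCast_zsmul v (m.natAbs + c * l.natAbs)]
      module

end Summit.ResolutionOfSingularities.ResolutionOfSingularities.Theorems.FRationalResolution.VertexChartFaces
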